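import Summits.QuantumFields.YangMills.Theorems.IsotropyFromPowerCountingTemperedCurvatureMomentsSepDensity
import Summits.QuantumFields.YangMills.Theorems.IsotropyFromPowerCountingTemperedCurvatureMomentsTruncatedTieLimit
import Summits.QuantumFields.YangMills.Theorems.IsotropyFromPowerCountingTemperedCurvatureMomentsTemperedOfMeso
import Summits.QuantumFields.YangMills.Theorems.IsotropyFromPowerCountingTemperedCurvatureMomentsCondIndepCubes
import Summits.QuantumFields.YangMills.Theorems.IsotropyFromPowerCountingTemperedCurvatureMomentsShieldingHoelder
import Summits.QuantumFields.YangMills.Theorems.IsotropyFromPowerCountingTemperedCurvatureMomentsMesoOfShielded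
import Summits.QuantumFields.YangMills.Theorems.TemperedCurvatureMoments.Negative.TieLoadBearing

/-!
# `TemperedCurvatureMoments` (T, stmt-QuantumFields-17721) from fixed-scale bounds: T ⟸ MESO ⟸ CH

Support file of the line `Sketch` (cards `markov-shielding` / `entropic-shielding`) of crux T: the sorry-free
COMPOSITION of the line's six landed stubs, i.e. the two certified reductions of the item

* `temperedCurvatureMoments_of_meso` — **T ⟸ MESO.**  T follows (by name) as soon as, for every compact simple `G`,
  `r`, `sch`, `S₁` with `W1 r sch S₁`, the eight frames and the cone, and every degree `n > 0`, the TRUE renormalised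
  moment density `c_kⁿ W_k` (`torusMoment`) is tempered at a FIXED physical scale, EVENTUALLY in `k`:
  `∃ C N, ∀ s ∈ (0,1], ∃ k₀, ∀ k ≥ k₀, |c_kⁿ W_k(x)| ≤ C s^{-N}` at multi-sites of the inner half-box with pairwise
  physical separations `≥ s` (MESO(n); no bound below the scale `s`, none near the torus seam, `k₀` may depend on
  `s`).  Composition of `stub_temperedOfMeso` (the truncated true density, p145050), `stub_truncatedTieLimit`
  (equicontinuity + density, p144831) and `stub_sepDensity` (separated compactly supported real product tensors are
  dense in `⁰𝒮`, p144963).  This strictly strengthens `temperedCurvatureMoments_of_trueDensity_tempered` (p140303),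
  whose `k`-uniform all-separation hypothesis fails on super-polynomial-`c_k` schemes.
* `temperedCurvatureMoments_of_shieldedMomentBound` — **T ⟸ CH.**  T follows (by name) from the one-point bound
  CH_n: for every such `(G, r, sch, S₁, n)` there are `C, p` with, for every physical radius `ρ ∈ (0,1]`, eventually
  in `k`, at every site `y` of the inner half-box, `‖E_k[c_k(F(τ_yŨ) − m_k) | links based outside the sup-cube of
  radius ⌊ρ/a_k⌋ around y]‖_{Lⁿ(μ_k)} ≤ C ρ^{-p}` (`μ_k` Wilson's torus measure at `β_k` on the torus of side
  `2L_k+1`).  Composition of the previous theorem with the Markov shielding `MESO ⟸ CH`: `stub_condIndepCubes` (DLR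
  conditional independence of separated cubes, p145262), `stub_shieldingHoelder` (tower + generalised Hölder,
  p144977), `stub_mesoOfShielded` (cube geometry, p145282).

CH_n is the Yang–Mills content of the line (UV power counting of `tr F²` in one-point form, expected `p = 4`); it is
the registered stub `stub_shieldedMomentBound` of `Cruxes/TemperedCurvatureMoments/Lines/Sketch.lean` and is NOT
proved here.  Both theorems are unconditional implications (no named fact is assumed).

References: Osterwalder–Schrader 1973 §2, 1975 §2; Glimm–Jaffe 1987 §9.5–9.6, §19; Friedli–Velenik 2017 §6.3;
Georgii 2011 Rem. 1.24.
-/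

noncomputable section

-- tree-known workaround (cf. the imported support file)
attribute [-instance] SimplexCategory.instFintypeToTypeOrderHomFinHAddNatLenOfNat

namespace Summit.QuantumFields.YangMills.Theorems.TemperedCurvatureMoments.Sketch

open scoped BigOperators SchwartzMap ENNReal
open MeasureTheory Filter Topology ProbabilityTheory
open Literature.MathematicalPhysics.QuantumFieldTheory Literature.MathematicalPhysics.QuantumLattice
open Literature.MathematicalPhysics.AQFT
open Literature.Probability.LatticeModels (box Site)
open Summit.QuantumFields.YangMills.Theorems.OSLegsFromFemtoAndGap (torusMoment)
open Summit.QuantumFields.YangMills.Theorems.CurvatureBoostCovariance.Negative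
  (Tie W1 EightFrameRP PlanarCone)
open Summit.QuantumFields.YangMills.Theorems.NPointIsotropy.Negative (E4)
open Summit.QuantumFields.YangMills.Theses.IsotropyFromPowerCounting (TemperedCurvatureMoments)
open Summit.QuantumFields.YangMills.Theorems.TemperedCurvatureMoments.Negative (TemperedApproximants)

variable {G : Type} [Group G] [TopologicalSpace G] [IsTopologicalGroup G] [CompactSpace G]
  [MeasurableSpace G] [BorelSpace G]

/-! ## Pointwise in `(r, sch, S₁, n)`: the degree-`n` conclusion of T (`TemperedApproximants`) -/

/-- **MESO(n) ⇒ T(n) at `(r, sch, S₁)`** (the mesoscopic reduction, pointwise).  If `S₁` is tied to the scheme and the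
true renormalised density `c_kⁿ W_k` of degree `n > 0` is tempered at fixed physical scale, eventually in `k`, on the
inner half-box, then the degree-`n` conclusion of T holds at `(sch.a, sch.L, S₁)` — `TemperedApproximants` of the
negative-side file, definitionally T's conclusion (`temperedCurvatureMoments_iff`).  Only the tie is used. -/
theorem temperedApproximants_of_meso (r : LatticeRep G) (sch : SpeciesScheme (YMSpecies G))
    (S₁ : SchwingerFamily E4) (htie : Tie r sch S₁) {n : ℕ} (hn : 0 < n)
    (hmeso : ∃ (C : ℝ) (N : ℕ), 0 < C ∧ ∀ s : ℝ, 0 < s → s ≤ 1 → ∃ k₀ : ℕ, ∀ k : ℕ, k₀ ≤ k →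
          ∀ x : Fin n → Site 4, (∀ i, x i ∈ box 4 (sch.L k / 2)) →
            (∀ i j, i ≠ j → s ≤ ‖sch.a k • siteToE (x i) - sch.a k • siteToE (x j)‖) →
            |(sch.c r.curvature k) ^ n *
                torusMoment r.ρ (sch.β k) (sch.L k) r.curvature.F (sch.m r.curvature k) x| ≤ C * s⁻¹ ^ N) :
    TemperedApproximants sch.a sch.L S₁ n := by
  -- (A3): the witness
  obtain ⟨D, C, N, k₀, hC0, htemp, hsepTie⟩ := stub_temperedOfMeso r sch S₁ htie hn hmeso
  refine ⟨D, C, N, k₀, hC0, htemp, ?_⟩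
  intro f F hF hF'
  -- (A2) over (A1): convergence on all of ⁰𝒮, in particular on the real tensor `F = ⊗ f`
  have hlim := stub_truncatedTieLimit n hn (stub_sepDensity n) (S₁ n) sch.a sch.L D C N k₀
    sch.a_pos sch.tendsto_a sch.tendsto_L htemp hsepTie F hF'
  refine hlim.congr fun k => ?_
  push_cast
  rw [Finset.mul_sum, Finset.mul_sum]
  refine Finset.sum_congr rfl fun x _ => ?_
  rw [hF]
  simp [ofRealTest_apply]

/-- **CH_n ⇒ T(n) at `(r, sch, S₁)`** (Markov shielding, pointwise).  If `S₁` is tied to the scheme and the shielded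
moment bound CH_n holds for `(r, sch)` — for every physical radius `ρ ∈ (0,1]`, eventually in `k`, at every site of the
inner half-box the `Lⁿ(μ_k)` norm of `E_k[c_k(F(τ_yŨ) − m_k) | links based outside the sup-cube of radius ⌊ρ/a_k⌋
around y]` is `≤ C ρ^{-p}` — then the degree-`n` conclusion of T holds at `(sch.a, sch.L, S₁)`: CH_n ⇒ MESO(n)
(`stub_mesoOfShielded` over `stub_condIndepCubes`, `stub_shieldingHoelder`), then `temperedApproximants_of_meso`. -/
theorem temperedApproximants_of_shieldedMomentBound (r : LatticeRep G) (sch : SpeciesScheme (YMSpecies G))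
    (S₁ : SchwingerFamily E4) (htie : Tie r sch S₁) {n : ℕ} (hn : 0 < n)
    (hCH : ∃ (C p : ℝ), 0 < C ∧ ∀ ρ : ℝ, 0 < ρ → ρ ≤ 1 → ∃ k₀ : ℕ, ∀ k : ℕ, k₀ ≤ k →
          ∀ y : Site 4, y ∈ box 4 (sch.L k / 2) →
            (∫ U, |((wilsonMeasure r.ρ (sch.β k) : Measure (GaugeConfig 4 (2 * sch.L k + 1) G))[(fun U =>
                sch.c r.curvature k *
                  (r.curvature.F (configShift (-y) (torusLift (2 * sch.L k + 1) U)) - sch.m r.curvature k)) |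
                cylinderEvents {ℓ : Edge 4 (2 * sch.L k + 1) | ¬ ∀ ν : Fin 4,
                  (ℓ.1 ν - ((y ν : ℤ) : ZMod (2 * sch.L k + 1)) +
                    ((⌊ρ / sch.a k⌋₊ : ℕ) : ZMod (2 * sch.L k + 1))).val ≤ 2 * ⌊ρ / sch.a k⌋₊}]) U| ^ n
              ∂(wilsonMeasure r.ρ (sch.β k) : Measure (GaugeConfig 4 (2 * sch.L k + 1) G))) ^ ((n : ℝ)⁻¹) ≤
              C * ρ ^ (-p)) :
    TemperedApproximants sch.a sch.L S₁ n :=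
  temperedApproximants_of_meso r sch S₁ htie hn
    (stub_mesoOfShielded (G := G)
      (fun G _ _ _ _ _ _ r β S R hRS _ y hsep φ hφm hφb hφd =>
        stub_condIndepCubes (G := G) r β S R hRS y hsep φ hφm hφb hφd)
      (fun hm μ _ _ hn φ hφm hφb hci => stub_shieldingHoelder hm μ hn φ hφm hφb hci)
      r sch hn hCH)

/-! ## T ⟸ MESO -/

/-- **T from MESO (the mesoscopic reduction, all degrees).**  If for every compact simple `G`, `r`, `sch`, `S₁`
with `W1 r sch S₁`, the eight frames and the cone, and every `n > 0`, the true renormalised density `c_kⁿ W_k` is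
tempered at fixed physical scale eventually in `k` on the inner half-box (MESO(n)), then `TemperedCurvatureMoments`
holds: the truncated true density (`stub_temperedOfMeso`) is tempered and its Riemann sums converge on the separated
compactly supported real product tensors, hence on all of `⁰𝒮` (`stub_truncatedTieLimit` over `stub_sepDensity`). -/
theorem temperedCurvatureMoments_of_meso
    (hmeso : ∀ (G : Type) [Group G] [TopologicalSpace G] [IsTopologicalGroup G] [CompactSpace G]
      [MeasurableSpace G] [BorelSpace G], IsCompactSimpleLieGroup G →
      ∀ (r : LatticeRep G) (sch : SpeciesScheme (YMSpecies G)) (S₁ : SchwingerFamily E4),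
        W1 r sch S₁ → EightFrameRP S₁ → PlanarCone S₁ → ∀ n : ℕ, 0 < n →
        ∃ (C : ℝ) (N : ℕ), 0 < C ∧ ∀ s : ℝ, 0 < s → s ≤ 1 → ∃ k₀ : ℕ, ∀ k : ℕ, k₀ ≤ k →
          ∀ x : Fin n → Site 4, (∀ i, x i ∈ box 4 (sch.L k / 2)) →
            (∀ i j, i ≠ j → s ≤ ‖sch.a k • siteToE (x i) - sch.a k • siteToE (x j)‖) →
            |(sch.c r.curvature k) ^ n *
                torusMoment r.ρ (sch.β k) (sch.L k) r.curvature.F (sch.m r.curvature k) x| ≤ C * s⁻¹ ^ N) :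
    TemperedCurvatureMoments := by
  intro G _ _ _ _ _ _ hG r sch S₁ hW h8 hC n hn
  exact temperedApproximants_of_meso r sch S₁ hW.1 hn (hmeso G hG r sch S₁ hW h8 hC n hn)

/-! ## T ⟸ CH -/

/-- **T from CH (Markov shielding, all degrees).**  If for every compact simple `G`, `r`, `sch`, `S₁` with
`W1 r sch S₁`, the eight frames and the cone, and every `n > 0`, the shielded moment bound CH_n holds — the
`Lⁿ(μ_k)` law of the shielded renormalised curvature at fixed physical radius `ρ` is `≤ C ρ^{-p}` eventually in `k`
— then `TemperedCurvatureMoments` holds: CH_n ⇒ MESO(n) by conditioning Wilson's torus Gibbs measure on the links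
outside disjoint cubes (`stub_mesoOfShielded` over `stub_condIndepCubes`, `stub_shieldingHoelder`), then
`temperedCurvatureMoments_of_meso`. -/
theorem temperedCurvatureMoments_of_shieldedMomentBound
    (hCH :
    ∀ (G : Type) [Group G] [TopologicalSpace G] [IsTopologicalGroup G] [CompactSpace G]
      [MeasurableSpace G] [BorelSpace G], IsCompactSimpleLieGroup G →
      ∀ (r : LatticeRep G) (sch : SpeciesScheme (YMSpecies G)) (S₁ : SchwingerFamily E4),
        W1 r sch S₁ → EightFrameRP S₁ → PlanarCone S₁ → ∀ n : ℕ, 0 < n →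
        ∃ (C p : ℝ), 0 < C ∧ ∀ ρ : ℝ, 0 < ρ → ρ ≤ 1 → ∃ k₀ : ℕ, ∀ k : ℕ, k₀ ≤ k →
          ∀ y : Site 4, y ∈ box 4 (sch.L k / 2) →
            (∫ U, |((wilsonMeasure r.ρ (sch.β k) : Measure (GaugeConfig 4 (2 * sch.L k + 1) G))[(fun U =>
                sch.c r.curvature k *
                  (r.curvature.F (configShift (-y) (torusLift (2 * sch.L k + 1) U)) - sch.m r.curvature k)) |
                cylinderEvents {ℓ : Edge 4 (2 * sch.L k + 1) | ¬ ∀ ν : Fin 4,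
                  (ℓ.1 ν - ((y ν : ℤ) : ZMod (2 * sch.L k + 1)) +
                    ((⌊ρ / sch.a k⌋₊ : ℕ) : ZMod (2 * sch.L k + 1))).val ≤ 2 * ⌊ρ / sch.a k⌋₊}]) U| ^ n
              ∂(wilsonMeasure r.ρ (sch.β k) : Measure (GaugeConfig 4 (2 * sch.L k + 1) G))) ^ ((n : ℝ)⁻¹) ≤
              C * ρ ^ (-p)) :
    TemperedCurvatureMoments := by
  intro G _ _ _ _ _ _ hG r sch S₁ hW h8 hC n hn
  exact temperedApproximants_of_shieldedMomentBound r sch S₁ hW.1 hn (hCH G hG r sch S₁ hW h8 hC n hn)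

end Summit.QuantumFields.YangMills.Theorems.TemperedCurvatureMoments.Sketch

end
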